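import Summits.SmoothPoincare4.SmoothPoincare4.Theorems.ContractibleTwistedDoubleStandard.Negative.DoubleBisection
import Literature.AlgebraicTopology.SingularHomology.ExcisionMayerVietoris

/-!
# `AcyclicBisectionRigidity` — negative-side support: the double (identity-glued) sector

Support lemma for the crux
`Summit.SmoothPoincare4.SmoothPoincare4.Theses.ConvexBisection.AcyclicBisectionRigidity`
(stmt-SmoothPoincare4-10507), from the standing disprover's work file
`Cruxes/AcyclicBisectionRigidity/Disproof.lean` §12:

* `doubleSector_of_crux` — GIVEN the crux, every double `P = W ∪_id W`
  (`Literature.Topology.FourManifolds.IsDouble`) of ONE compact ℚ-acyclic Stein domain `(W, J)`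
  that is a homotopy 4-sphere is diffeomorphic to `S⁴` (doubles are Stein bisections along a
  common contact seam with the same structure on both halves: sibling theorem
  `steinBisection_of_isDouble`, p69875). On paper this sector is EXACTLY the presentation-sphere
  sector of crux 4 (`ContractibleTwistedDoubleStandard`): a simply connected double of a
  ℚ-acyclic compact `W` forces `W` contractible (`π₁ W ↪ π₁ D(W) = G ∗_H G`; then `H₂ W = 0` by
  duality), so an exotic presentation sphere `Σ(𝒫, ε)` is what a refutation through this sector
  would have to be, and the crux adds nothing identity-glued beyond crux 4.
-/

noncomputable section

-- The namespace is prescribed by the crux protocol (`Summit.<P>.<Sub>.Theorems.<Crux>.Negative`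
-- with `P = Sub = SmoothPoincare4`), hence the duplicated component.
set_option linter.dupNamespace false

open scoped Manifold ContDiff Topology ContinuousMap
open Set Function Literature.Geometry.Symplectic Literature.AlgebraicTopology.SingularHomology
  Literature.Topology.FourManifolds CategoryTheory.Limits

namespace Summit.SmoothPoincare4.SmoothPoincare4.Theorems.AcyclicBisectionRigidity.Negative

open Summit.SmoothPoincare4.SmoothPoincare4.Theses.ConvexBisection
open Summit.SmoothPoincare4.SmoothPoincare4.Theorems.ContractibleTwistedDoubleStandard.Negative
  (steinBisection_of_isDouble)

/-- **The crux implies its double sector.** Given `AcyclicBisectionRigidity`: if `(W, J)` is a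
compact Stein domain with `H_k(W; ℚ) = 0` for `k > 0`, `b` a boundary datum of `W`, and `P` a
(Hausdorff, second countable, smooth) double of `W` along `b` which is a homotopy 4-sphere, then
`P ≅ S⁴`. Proof: `steinBisection_of_isDouble` supplies the six bisection hypotheses for
`(P; W, W; J, J)`, and acyclicity of both halves is the hypothesis on `W`. [folklore] -/
theorem doubleSector_of_crux (h : AcyclicBisectionRigidity)
    (W : Type) [TopologicalSpace W] [ChartedSpace (EuclideanHalfSpace 4) W] [IsManifold (𝓡∂ 4) ∞ W]
    [CompactSpace W] (J : SteinStructure W) (b : BoundaryData (𝓡∂ 4) W (𝓡 3))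
    (hac : ∀ k, 0 < k → IsZero (singularHomology ℚ ℚ W k))
    (P : Type) [TopologicalSpace P] [T2Space P] [SecondCountableTopology P]
    [ChartedSpace (EuclideanSpace ℝ (Fin 4)) P] [IsManifold (𝓡 4) ∞ P] (hD : IsDouble b (𝓡 4) P)
    (hP : P ≃ₕ Metric.sphere (0 : EuclideanSpace ℝ (Fin 5)) 1) :
    Nonempty (P ≃ₘ⟮𝓡 4, 𝓡 4⟯ Metric.sphere (0 : EuclideanSpace ℝ (Fin 5)) 1) := by
  obtain ⟨jA, jB, hA, hB, hU, hL, hR, hC⟩ := steinBisection_of_isDouble b J hD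
  exact h P hP ⟨W, _, _, _, _, W, _, _, _, _, J, J, jA, jB, hA, hB, hU, hL, hR, hC,
    fun k hk => ⟨hac k hk, hac k hk⟩⟩

end Summit.SmoothPoincare4.SmoothPoincare4.Theorems.AcyclicBisectionRigidity.Negative
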